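import Summits.KontsevichZagierPeriods.KontsevichZagierPeriods.Theorems.SoloInformedToricLinearPart
import HarnessLib

/-!
# Cube-nondegeneracy from dominant pure powers (LEMMA DOM)

Solo programme `solo-KontsevichZagierPeriods-informed`, session s105.

A criterion for cube-nondegeneracy (`SoloInformedCubeNondegenerate`, the hypothesis of THEOREM
ND-GEN) that tolerates mixed signs, generalising LEMMA LIN
(`soloInformed_cubeNondegenerate_of_linear`, the case `k = 1`, `R` = higher-order terms):

* **LEMMA DOM** `soloInformed_cubeNondegenerate_of_dominant`: let
  `Q = ∑ᵢ cᵢ xᵢ^{kᵢ} + R` with `kᵢ ≥ 1`, `cᵢ > 0`, every monomial of `R` strictly divisible by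
  some `xᵢ^{kᵢ}`, and `Q ≠ 0` on the punctured closed cube `[0,1]ⁿ ∖ {0}`.  Then `Q` is
  cube-nondegenerate: for a weight with a zero entry the initial form is `Q` on a coordinate
  face, and for a positive weight the initial exponents are among the pure powers `kᵢ eᵢ`
  (a monomial strictly divisible by `xᵢ^{kᵢ}` has larger weighted degree), so the initial form
  is a non-empty positive combination of pure powers.
* Examples (the chart denominators of the first cube-DEGENERATE denominators treated in
  `SoloInformedToricCuspCharts`): `x₀ + x₁²` (`soloInformed_cubeNondegenerate_XAddSq`) and
  `x₀² + x₁ (1 − x₀)³ = x₀² + x₁ − 3x₀x₁ + 3x₀²x₁ − x₀³x₁`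
  (`soloInformed_cubeNondegenerate_cuspChartDen`), which has mixed signs and vanishing linear
  part in `x₀`, so that neither THEOREM TOR nor LEMMA LIN applies.

References: A. G. Kouchnirenko, *Polyèdres de Newton et nombres de Milnor*, Invent. Math. 32
(1976) §1 (Newton nondegeneracy, convenient polynomials); M. Kontsevich, D. Zagier, *Periods*
(2001) §1.2.
-/

noncomputable section

open scoped BigOperators
open MeasureTheory Set
open Literature.NumberTheory.Transcendental Literature.NumberTheory.Transcendental.KZ

namespace Summit.KontsevichZagierPeriods.KontsevichZagierPeriods.Theorems

variable {n : ℕ}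

/-! ### Weighted degrees of pure powers and strict divisibility -/

/-- `⟨w, k eᵢ⟩ = wᵢ k`. [this work] -/
theorem soloInformed_wdeg_single_mul (w : Fin n → ℕ) (i : Fin n) (k : ℕ) :
    soloInformedWDeg w (Finsupp.single i k) = w i * k := by
  classical
  simp [soloInformedWDeg, Finsupp.single_apply]

/-- Strict divisibility raises the weighted degree for a positive weight. [this work] -/
theorem soloInformed_wdeg_lt_of_le_of_ne (w : Fin n → ℕ) (hw : ∀ i, 0 < w i) {s a : Fin n →₀ ℕ}
    (hle : s ≤ a) (hne : s ≠ a) : soloInformedWDeg w s < soloInformedWDeg w a := by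
  obtain ⟨j, hj⟩ : ∃ j, s j < a j := by
    by_contra h
    push Not at h
    exact hne (le_antisymm hle (Finsupp.le_def.2 h))
  unfold soloInformedWDeg
  exact Finset.sum_lt_sum (fun i _ => Nat.mul_le_mul_left (w i) (Finsupp.le_def.1 hle i))
    ⟨j, Finset.mem_univ _, (Nat.mul_lt_mul_left (hw j)).2 hj⟩

/-- `k eⱼ ≤ kᵢ eᵢ` strictly is impossible for positive exponents. [this work] -/
theorem soloInformed_not_single_lt_single (k : Fin n → ℕ) (hk : ∀ i, 0 < k i) (i j : Fin n)
    (hle : Finsupp.single j (k j) ≤ Finsupp.single i (k i))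
    (hne : Finsupp.single j (k j) ≠ Finsupp.single i (k i)) : False := by
  by_cases hji : j = i
  · subst hji
    exact hne rfl
  · have h := Finsupp.le_def.1 hle j
    rw [Finsupp.single_eq_same, Finsupp.single_eq_of_ne hji] at h
    exact (hk j).ne' (Nat.le_zero.1 h)

/-! ### LEMMA DOM -/

open Classical in
/-- **LEMMA DOM — cube-nondegeneracy from dominant pure powers.**  Let `n ≥ 1`,
`Q = ∑ᵢ cᵢ xᵢ^{kᵢ} + R ∈ ℚ[x₁, …, xₙ]` with all `kᵢ ≥ 1`, all `cᵢ > 0`, every exponent of `R`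
strictly divisible by some `kᵢ eᵢ`, and `Q` without zero on the punctured closed cube
`[0,1]ⁿ ∖ {0}`.  Then `Q` is cube-nondegenerate. [this work; cf. Kouchnirenko 1976 §1] -/
theorem soloInformed_cubeNondegenerate_of_dominant (hn : 0 < n) (k : Fin n → ℕ)
    (hk : ∀ i, 0 < k i) (c : Fin n → ℚ) (hc : ∀ i, 0 < c i) (R : MvPolynomial (Fin n) ℚ)
    (hR : ∀ a ∈ R.support, ∃ i, Finsupp.single i (k i) ≤ a ∧ Finsupp.single i (k i) ≠ a)
    (hpos : ∀ x : Fin n → ℝ, (∀ i, 0 ≤ x i ∧ x i ≤ 1) → x ≠ 0 →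
      MvPolynomial.aeval x
        ((∑ i, MvPolynomial.monomial (Finsupp.single i (k i)) (c i)) + R) ≠ 0) :
    SoloInformedCubeNondegenerate
      ((∑ i, MvPolynomial.monomial (Finsupp.single i (k i)) (c i)) + R) := by
  set S : MvPolynomial (Fin n) ℚ := ∑ i, MvPolynomial.monomial (Finsupp.single i (k i)) (c i)
    with hS
  set Q : MvPolynomial (Fin n) ℚ := S + R with hQ
  -- coefficients of `S`
  have hinj : ∀ i j, Finsupp.single j (k j) = Finsupp.single i (k i) → j = i := by
    intro i j h
    by_contra hji
    have h' := Finsupp.ext_iff.1 h j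
    rw [Finsupp.single_eq_same, Finsupp.single_eq_of_ne hji] at h'
    exact (hk j).ne' h'
  have hcoeffS : ∀ a, MvPolynomial.coeff a S =
      ∑ i, if Finsupp.single i (k i) = a then c i else 0 := by
    intro a
    rw [hS, MvPolynomial.coeff_sum]
    exact Finset.sum_congr rfl fun i _ => MvPolynomial.coeff_monomial _ _ _
  have hcoeffS_single : ∀ i, MvPolynomial.coeff (Finsupp.single i (k i)) S = c i := by
    intro i
    rw [hcoeffS, Finset.sum_eq_single i (fun j _ hji => if_neg fun h => hji (hinj i j h))
      (fun h => (h (Finset.mem_univ i)).elim), if_pos rfl]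
  have hcoeffS_zero : ∀ a, (∀ i, Finsupp.single i (k i) ≠ a) → MvPolynomial.coeff a S = 0 :=
    fun a ha => by rw [hcoeffS]; exact Finset.sum_eq_zero fun i _ => if_neg (ha i)
  -- `R` has no pure-power terms `kᵢ eᵢ`
  have hRsingle : ∀ i, MvPolynomial.coeff (Finsupp.single i (k i)) R = 0 := by
    intro i
    by_contra h
    obtain ⟨j, hle, hne⟩ := hR _ (MvPolynomial.mem_support_iff.2 h)
    exact soloInformed_not_single_lt_single k hk i j hle hne
  have hQsingle : ∀ i, MvPolynomial.coeff (Finsupp.single i (k i)) Q = c i := fun i => by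
    rw [hQ, MvPolynomial.coeff_add, hcoeffS_single, hRsingle, add_zero]
  have hsuppk : ∀ i, Finsupp.single i (k i) ∈ Q.support := fun i =>
    MvPolynomial.mem_support_iff.2 (by rw [hQsingle]; exact (hc i).ne')
  -- the support of `Q`: pure powers or exponents of `R`
  have hsuppQ : ∀ a ∈ Q.support, (∃ i, a = Finsupp.single i (k i)) ∨ a ∈ R.support := by
    intro a ha
    by_cases haR : a ∈ R.support
    · exact Or.inr haR
    · left
      by_contra hnot
      push Not at hnot
      have h1 : MvPolynomial.coeff a S = 0 := hcoeffS_zero a fun i h => hnot i h.symm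
      have h2 : MvPolynomial.coeff a R = 0 := MvPolynomial.notMem_support_iff.1 haR
      exact MvPolynomial.mem_support_iff.1 ha (by rw [hQ, MvPolynomial.coeff_add, h1, h2, add_zero])
  have h0' : ∀ a ∈ Q.support, a ≠ 0 := by
    intro a ha h0
    rcases hsuppQ a ha with ⟨i, hi⟩ | haR
    · have := Finsupp.ext_iff.1 hi i
      rw [h0, Finsupp.zero_apply, Finsupp.single_eq_same] at this
      exact (hk i).ne' this.symm
    · obtain ⟨i, hle, hne⟩ := hR a haR
      have := Finsupp.le_def.1 hle i
      rw [h0, Finsupp.zero_apply, Finsupp.single_eq_same] at this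
      exact (hk i).ne' (Nat.le_zero.1 this)
  intro w y hy
  rw [soloInformed_aeval_initForm]
  by_cases hw : ∃ i, w i = 0
  · -- Case A: `w` has a zero entry — the initial form is `Q` on a coordinate face
    obtain ⟨i₀, hi₀⟩ := hw
    set z : Fin n → ℝ := fun i => if w i = 0 then y i else 0 with hz
    have hzcube : ∀ i, 0 ≤ z i ∧ z i ≤ 1 := by
      intro i
      by_cases h : w i = 0
      · simp only [hz, h, if_true]; exact ⟨(hy i).1.le, (hy i).2⟩
      · simp only [hz, h, if_false]; exact ⟨le_rfl, zero_le_one⟩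
    have hz0 : z ≠ 0 := fun h => (hy i₀).1.ne' (by simpa [hz, hi₀] using congr_fun h i₀)
    have hzQ := hpos z hzcube hz0
    -- `a` is initial iff `⟨w, a⟩ = 0`
    have hinit : ∀ a ∈ Q.support, (SoloInformedIsInit w Q a ↔ soloInformedWDeg w a = 0) := by
      intro a _
      constructor
      · intro h
        have h1 := h _ (hsuppk i₀)
        rw [soloInformed_wdeg_single_mul, hi₀, zero_mul] at h1
        exact Nat.le_zero.1 h1
      · intro h b _
        rw [h]
        exact Nat.zero_le _
    -- `z^a = y^a` if `⟨w, a⟩ = 0`, else `0`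
    have hza : ∀ a : Fin n →₀ ℕ, (∏ i, z i ^ a i) =
        if soloInformedWDeg w a = 0 then ∏ i, y i ^ a i else 0 := by
      intro a
      split_ifs with h
      · rw [soloInformed_wdeg_eq_zero_iff] at h
        refine Finset.prod_congr rfl fun i _ => ?_
        rcases h i with hi | hi
        · simp only [hz, hi, if_true]
        · simp only [hi, pow_zero]
      · rw [soloInformed_wdeg_eq_zero_iff] at h
        push Not at h
        obtain ⟨i, hwi, hai⟩ := h
        exact Finset.prod_eq_zero (Finset.mem_univ i) (by simp [hz, hwi, hai])
    have hsum : (∑ a ∈ Q.support.filter (SoloInformedIsInit w Q),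
        algebraMap ℚ ℝ (MvPolynomial.coeff a Q) * ∏ i, y i ^ a i) = MvPolynomial.aeval z Q := by
      rw [soloInformed_aeval_eq_sum_support, Finset.sum_filter]
      refine Finset.sum_congr rfl fun a ha => ?_
      rw [hza a]
      by_cases h : soloInformedWDeg w a = 0
      · rw [if_pos ((hinit a ha).2 h), if_pos h]
      · rw [if_neg (fun h' => h ((hinit a ha).1 h')), if_neg h, mul_zero]
    rw [hsum]
    exact hzQ
  · -- Case B: all entries of `w` positive — the initial exponents are pure powers `kᵢ eᵢ`
    push Not at hw
    have hw' : ∀ i, 0 < w i := fun i => Nat.pos_of_ne_zero (hw i)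
    have hkey : ∀ a ∈ Q.support, SoloInformedIsInit w Q a → ∃ i, a = Finsupp.single i (k i) := by
      intro a ha hinit
      rcases hsuppQ a ha with h | haR
      · exact h
      · obtain ⟨i, hle, hne⟩ := hR a haR
        exact absurd (hinit _ (hsuppk i))
          (not_le.2 (soloInformed_wdeg_lt_of_le_of_ne w hw' hle hne))
    -- every initial term is positive on `(0,1]ⁿ` …
    have hterm : ∀ a ∈ Q.support.filter (SoloInformedIsInit w Q),
        0 < algebraMap ℚ ℝ (MvPolynomial.coeff a Q) * ∏ i, y i ^ a i := by
      intro a ha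
      obtain ⟨ha, hinit⟩ := Finset.mem_filter.1 ha
      obtain ⟨i, rfl⟩ := hkey a ha hinit
      refine mul_pos ?_ (Finset.prod_pos fun j _ => pow_pos (hy j).1 _)
      rw [eq_ratCast, hQsingle]
      exact_mod_cast hc i
    -- … and some exponent is initial
    have hne : Q.support.Nonempty := ⟨_, hsuppk ⟨0, hn⟩⟩
    obtain ⟨a₁, ha₁, hmin⟩ := Finset.exists_min_image Q.support (soloInformedWDeg w) hne
    have ha₁' : a₁ ∈ Q.support.filter (SoloInformedIsInit w Q) :=
      Finset.mem_filter.2 ⟨ha₁, fun b hb => hmin b hb⟩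
    exact (lt_of_lt_of_le (hterm _ ha₁')
      (Finset.single_le_sum (fun a ha => (hterm a ha).le) ha₁')).ne'

/-! ### Two-variable bookkeeping -/

/-- Two-variable monomials as products of powers. [folklore] -/
theorem soloInformed_monomial_fin_two (a b : ℕ) (c : ℚ) :
    MvPolynomial.monomial (Finsupp.single (0 : Fin 2) a + Finsupp.single 1 b) c =
      MvPolynomial.C c * MvPolynomial.X 0 ^ a * MvPolynomial.X 1 ^ b := by
  rw [MvPolynomial.X_pow_eq_monomial, MvPolynomial.X_pow_eq_monomial,
    MvPolynomial.C_mul_monomial, MvPolynomial.monomial_mul, mul_one, mul_one]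

/-- The pure-power part `∑ᵢ xᵢ^{kᵢ}` in two variables. [folklore] -/
theorem soloInformed_sum_monomial_fin_two (k : Fin 2 → ℕ) :
    (∑ i : Fin 2, MvPolynomial.monomial (Finsupp.single i (k i)) ((fun _ : Fin 2 => (1 : ℚ)) i)) =
      MvPolynomial.X 0 ^ k 0 + MvPolynomial.X 1 ^ k 1 := by
  rw [Fin.sum_univ_two, ← MvPolynomial.X_pow_eq_monomial, ← MvPolynomial.X_pow_eq_monomial]

/-- `x₁^{k₁}` strictly divides `x₀^a x₁^{k₁}` for `a ≥ 1`. [folklore] -/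
theorem soloInformed_single_one_lt (a k₁ : ℕ) (ha : 0 < a) :
    Finsupp.single (1 : Fin 2) k₁ ≤ Finsupp.single 0 a + Finsupp.single 1 k₁ ∧
      Finsupp.single (1 : Fin 2) k₁ ≠ Finsupp.single 0 a + Finsupp.single 1 k₁ := by
  refine ⟨Finsupp.le_def.2 fun j => ?_, fun h => ?_⟩
  · rw [Finsupp.add_apply]
    exact le_add_self
  · have h0 := Finsupp.ext_iff.1 h 0
    simp at h0
    omega

/-! ### Example: `x₀ + x₁²` -/

/-- `x₀ + x₁²` is cube-nondegenerate (LEMMA DOM with `k = (1, 2)`, `R = 0`; also a case of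
THEOREM TOR's positive coefficients). [this work] -/
theorem soloInformed_cubeNondegenerate_XAddSq :
    SoloInformedCubeNondegenerate
      (MvPolynomial.X 0 + MvPolynomial.X 1 ^ 2 : MvPolynomial (Fin 2) ℚ) := by
  have hS := soloInformed_sum_monomial_fin_two ![1, 2]
  simp only [Matrix.cons_val_zero, Matrix.cons_val_one, pow_one] at hS
  have h := soloInformed_cubeNondegenerate_of_dominant two_pos ![1, 2]
    (fun i => by fin_cases i <;> simp) (fun _ => (1 : ℚ)) (fun _ => one_pos) 0
    (fun a ha => by simp at ha) fun x hx hx0 => ?_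
  · rwa [add_zero, hS] at h
  · rw [add_zero, hS]
    simp only [map_add, map_pow, MvPolynomial.aeval_X]
    intro h
    have h0 : 0 ≤ x 0 := (hx 0).1
    have hx0' : x 0 = 0 := by nlinarith [sq_nonneg (x 1)]
    have hx1' : x 1 = 0 := by nlinarith [sq_nonneg (x 1)]
    exact hx0 (funext fun i => by fin_cases i <;> simp [hx0', hx1'])

/-! ### Example: the cusp-chart denominator `x₀² + x₁ (1 − x₀)³` -/

/-- The cusp-chart denominator `x₀² + x₁ (1 − x₀)³` (mixed signs, no linear term in `x₀`). -/
def soloInformedCuspChartDen : MvPolynomial (Fin 2) ℚ :=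
  MvPolynomial.X 0 ^ 2 + MvPolynomial.X 1 * (1 - MvPolynomial.X 0) ^ 3

/-- Its higher-order part `R = −3x₀x₁ + 3x₀²x₁ − x₀³x₁`, every monomial strictly divisible by
`x₁`. -/
def soloInformedCuspChartR : MvPolynomial (Fin 2) ℚ :=
  MvPolynomial.monomial (Finsupp.single 0 1 + Finsupp.single 1 1) (-3) +
    MvPolynomial.monomial (Finsupp.single 0 2 + Finsupp.single 1 1) 3 +
    MvPolynomial.monomial (Finsupp.single 0 3 + Finsupp.single 1 1) (-1)

/-- The cusp-chart denominator in the shape of LEMMA DOM (`k = (2, 1)`, `c = 1`). [this work] -/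
theorem soloInformed_cuspChartDen_eq :
    (∑ i : Fin 2, MvPolynomial.monomial (Finsupp.single i (![2, 1] i))
        ((fun _ : Fin 2 => (1 : ℚ)) i)) + soloInformedCuspChartR = soloInformedCuspChartDen := by
  rw [soloInformed_sum_monomial_fin_two, soloInformedCuspChartR, soloInformedCuspChartDen,
    soloInformed_monomial_fin_two, soloInformed_monomial_fin_two, soloInformed_monomial_fin_two]
  simp only [Matrix.cons_val_zero, Matrix.cons_val_one, map_neg, map_one, map_ofNat]
  ring

/-- Evaluation of the cusp-chart denominator. -/
theorem soloInformed_aeval_cuspChartDen (x : Fin 2 → ℝ) :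
    MvPolynomial.aeval x soloInformedCuspChartDen = x 0 ^ 2 + x 1 * (1 - x 0) ^ 3 := by
  simp [soloInformedCuspChartDen]

/-- The cusp-chart denominator vanishes on the closed square only at the origin. [this work] -/
theorem soloInformed_cuspChartDen_ne_zero (x : Fin 2 → ℝ) (hx : ∀ i, 0 ≤ x i ∧ x i ≤ 1)
    (hx0 : x ≠ 0) : MvPolynomial.aeval x soloInformedCuspChartDen ≠ 0 := by
  rw [soloInformed_aeval_cuspChartDen]
  intro h
  have h0 : 0 ≤ x 0 := (hx 0).1
  have h1 : 0 ≤ x 1 := (hx 1).1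
  have h2 : 0 ≤ 1 - x 0 := sub_nonneg.2 (hx 0).2
  have h3 : 0 ≤ x 1 * (1 - x 0) ^ 3 := mul_nonneg h1 (pow_nonneg h2 3)
  have hx0' : x 0 = 0 := by nlinarith [sq_nonneg (x 0)]
  rw [hx0', sub_zero, one_pow, mul_one] at h
  have hx1' : x 1 = 0 := by nlinarith
  exact hx0 (funext fun i => by fin_cases i <;> simp [hx0', hx1'])

/-- **The cusp-chart denominator `x₀² + x₁ (1 − x₀)³` is cube-nondegenerate** (LEMMA DOM with
`k = (2, 1)`: the monomials `x₀x₁, x₀²x₁, x₀³x₁` are strictly divisible by `x₁`).  Neither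
THEOREM TOR (mixed signs) nor LEMMA LIN (no linear term in `x₀`) applies. [this work] -/
theorem soloInformed_cubeNondegenerate_cuspChartDen :
    SoloInformedCubeNondegenerate soloInformedCuspChartDen := by
  rw [← soloInformed_cuspChartDen_eq]
  refine soloInformed_cubeNondegenerate_of_dominant two_pos ![2, 1]
    (fun i => by fin_cases i <;> simp) (fun _ => (1 : ℚ)) (fun _ => one_pos)
    soloInformedCuspChartR (fun a ha => ⟨1, ?_⟩) fun x hx hx0 => ?_
  · have hsub : soloInformedCuspChartR.support ⊆
        {Finsupp.single 0 1 + Finsupp.single 1 1, Finsupp.single 0 2 + Finsupp.single 1 1,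
          Finsupp.single 0 3 + Finsupp.single 1 1} := by
      unfold soloInformedCuspChartR
      refine MvPolynomial.support_add.trans (Finset.union_subset
        (MvPolynomial.support_add.trans (Finset.union_subset ?_ ?_)) ?_) <;>
        refine MvPolynomial.support_monomial_subset.trans ?_ <;> simp
    have ha' := hsub ha
    simp only [Finset.mem_insert, Finset.mem_singleton] at ha'
    simp only [Matrix.cons_val_one, Matrix.cons_val_zero]
    rcases ha' with rfl | rfl | rfl
    · exact soloInformed_single_one_lt 1 1 one_pos
    · exact soloInformed_single_one_lt 2 1 two_pos
    · exact soloInformed_single_one_lt 3 1 three_pos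
  · rw [soloInformed_cuspChartDen_eq]
    exact soloInformed_cuspChartDen_ne_zero x hx hx0

end Summit.KontsevichZagierPeriods.KontsevichZagierPeriods.Theorems
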